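import Summits.PneNP.PneNP.Theses.SzkEntropy
import Summits.PneNP.PneNP.Theorems.SzkEntropyPeaThreeNotInP
import Summits.PneNP.PneNP.Theorems.SzkEntropyPeaThreeNotInPKillSwitch
import Summits.PneNP.PneNP.Theorems.SzkEntropyPeaThreeNotInPConsequences
import Summits.PneNP.PneNP.Theorems.SzkEntropyPeaThreeNotInPCoreStubReduction
import Literature.Computability.Complexity.PolynomialEntropyApproximation
import Literature.Computability.Complexity.Space
import Literature.Computability.Complexity.CircuitClasses
import Literature.Computability.Complexity.ConstantDepth

/-!
# BC2(c) probes for candidate PIECES of a decomposition of X = `PeaThreeNotInP` (census companion)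

Each `example` runs the prescribed cheap probe `first | exact? | simpa | aesop` (400000 heartbeats).
Each chain ends in `| sorry`, so a FAILED probe elaborates as a `sorry` (warning at that line) and a
SUCCESSFUL probe leaves no sorry.  EXPECTED and OBSERVED (lean check 2026-08-17, rc 0): 10 sorries =
P1–P8, P12, P13 (restricted-model pieces W₁–W₃ and the simulation piece B₁ are not cheaply `≥ S` or
`≥ X`; these pieces die on clause (b), not (c)); NO sorry at P9 (the whole W₁ ∧ B₁ assembly is found
by `exact?` — trivial seam) and at P10/P11 (the line's open piece C⁺ = `TensorIsoFull ∉ PromiseP` is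
closed onto S and X by NAMED tree theorems — clause (c) fails).
-/

namespace Summit.PneNP.PneNP.Cruxes.PeaThreeNotInP.StrategyCensus.Probes

open Literature.Computability.Complexity
open Summit.PneNP.PneNP.Theses.SzkEntropy Summit.PneNP.PneNP.Theorems
open Summit.PneNP.PneNP.Cruxes.PeaThreeNotInP.TensorIsoLine

/-- W₁: entropy approximation of cubic maps is not in promise-LOGSPACE. -/
def W₁ : Prop := PEA 3 ∉ promiseLift LOGSPACE
/-- W₂: … not separated by quadratic-size circuits. -/
def W₂ : Prop := PEA 3 ∉ promiseLift (SIZE fun n => n ^ 2)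
/-- W₃: … not in promise-AC⁰. -/
def W₃ : Prop := PEA 3 ∉ promiseLift AC0
/-- B₁: the simulation piece "P-easiness of PEA₃ collapses to LOGSPACE-easiness". -/
def B₁ : Prop := PEA 3 ∈ PromiseP → PEA 3 ∈ promiseLift LOGSPACE
/-- C⁺: the line's open piece. -/
def Cplus : Prop := TensorIsoFull ∉ PromiseP

-- P1  W₁ → S
set_option maxHeartbeats 400000 in
example : W₁ → _root_.PneNP := by first | exact? | simpa [W₁] | (unfold W₁; simpa) | (aesop (config := { terminal := true })) | sorry
-- P2  W₁ → X
set_option maxHeartbeats 400000 in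
example : W₁ → PeaThreeNotInP := by first | exact? | simpa [W₁] | (unfold W₁; simpa) | (aesop (config := { terminal := true })) | sorry
-- P3  W₂ → S
set_option maxHeartbeats 400000 in
example : W₂ → _root_.PneNP := by first | exact? | simpa [W₂] | (unfold W₂; simpa) | (aesop (config := { terminal := true })) | sorry
-- P4  W₂ → X
set_option maxHeartbeats 400000 in
example : W₂ → PeaThreeNotInP := by first | exact? | simpa [W₂] | (unfold W₂; simpa) | (aesop (config := { terminal := true })) | sorry
-- P5  W₃ → S
set_option maxHeartbeats 400000 in
example : W₃ → _root_.PneNP := by first | exact? | simpa [W₃] | (unfold W₃; simpa) | (aesop (config := { terminal := true })) | sorry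
-- P6  W₃ → X
set_option maxHeartbeats 400000 in
example : W₃ → PeaThreeNotInP := by first | exact? | simpa [W₃] | (unfold W₃; simpa) | (aesop (config := { terminal := true })) | sorry
-- P7  B₁ → S
set_option maxHeartbeats 400000 in
example : B₁ → _root_.PneNP := by first | exact? | simpa [B₁] | (unfold B₁; simpa) | (aesop (config := { terminal := true })) | sorry
-- P8  B₁ → X
set_option maxHeartbeats 400000 in
example : B₁ → PeaThreeNotInP := by first | exact? | simpa [B₁] | (unfold B₁; simpa) | (aesop (config := { terminal := true })) | sorry
-- P9  W₁ ∧ B₁ → X : the whole "assembly" is found by the cheap probe itself (trivial seam, clause (b))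
set_option maxHeartbeats 400000 in
example : W₁ → B₁ → PeaThreeNotInP := by
  first | exact? | (unfold W₁ B₁; intro hW hB; exact szkEntropy_peaThreeNotInP_iff.2 fun h => hW (hB h)) | (aesop (config := { terminal := true })) | sorry
-- P10 C⁺ → S : EXPECTED TO SUCCEED (clause (c) fails for C⁺)
set_option maxHeartbeats 400000 in
example : Cplus → _root_.PneNP := by first | exact? | simpa [Cplus] | (unfold Cplus; exact?) | (aesop (config := { terminal := true })) | sorry
-- P11 C⁺ → X : EXPECTED TO SUCCEED
set_option maxHeartbeats 400000 in
example : Cplus → PeaThreeNotInP := by first | exact? | simpa [Cplus] | (unfold Cplus; exact?) | (aesop (config := { terminal := true })) | sorry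
-- P12 converse S → W₁ (is W₁ a consequence of S?) : expected to FAIL
set_option maxHeartbeats 400000 in
example : _root_.PneNP → W₁ := by first | exact? | simpa [W₁] | (unfold W₁; simpa) | (aesop (config := { terminal := true })) | sorry
-- P13 converse X → W₁ : W₁ IS a consequence of X (P ⊇ LOGSPACE) — is it cheaply found?
set_option maxHeartbeats 400000 in
example : PeaThreeNotInP → W₁ := by first | exact? | simpa [W₁] | (unfold W₁; simpa) | (aesop (config := { terminal := true })) | sorry

end Summit.PneNP.PneNP.Cruxes.PeaThreeNotInP.StrategyCensus.Probes
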